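import Mathlib
import HarnessLib
import Summits.ValiantsHypothesis.ValiantsHypothesis.Theses.MonotoneRestoration
import Literature.Computability.AlgebraicComplexity.ArithCircuit
import Literature.Computability.AlgebraicComplexity.ArithCircuitProofs
import Literature.Computability.AlgebraicComplexity.MonotoneStructure
import Literature.Computability.AlgebraicComplexity.PermanentIrreducible
import Literature.ModelTheory.FiniteModelTheory.CkEquiv
import Summits.ValiantsHypothesis.ValiantsHypothesis.Theorems.MonotoneRestorationMonotoneRestorationQPCosetCount
import Summits.ValiantsHypothesis.ValiantsHypothesis.Theorems.MonotoneRestorationMonotoneRestorationQPSymmetricLB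
import Summits.ValiantsHypothesis.ValiantsHypothesis.Theorems.MonotoneRestorationMonotoneRestorationQPSupportSymmetrisation
import Summits.ValiantsHypothesis.ValiantsHypothesis.Theorems.MonotoneRestorationMonotoneRestorationQPSparseRegime
import Summits.ValiantsHypothesis.ValiantsHypothesis.Theorems.MonotoneRestorationMonotoneRestorationQPBeta
import Literature.Computability.AlgebraicComplexity.SymmetricArithCircuit
import Literature.Computability.AlgebraicComplexity.DawarWilsenach2025Proofs
import Literature.GroupTheory.PermutationGroups.SmallIndexSubgroups
import Summits.ValiantsHypothesis.ValiantsHypothesis.Theorems.MonotoneRestorationQP.Negative.LoadBearing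
import Summits.ValiantsHypothesis.ValiantsHypothesis.Theorems.MonotoneRestorationMonotoneRestorationQPPermSupportCount
import Summits.ValiantsHypothesis.ValiantsHypothesis.Theorems.MonotoneRestorationMonotoneRestorationQPMulGateChildren

/-! TTRL-lite variant V18960 of stmt-ValiantsHypothesis-15886 -/

-- `ValiantsHypothesis.ValiantsHypothesis`: the D-0017 layout repeats the problem name in the path.
set_option linter.dupNamespace false

namespace Summit.ValiantsHypothesis.ValiantsHypothesis.Theorems

open Summit.ValiantsHypothesis.ValiantsHypothesis.Theses.MonotoneRestoration
open Literature.Computability.AlgebraicComplexity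

/-- **Root / output-gate case of the multiplication-gate spine** (TTRL-lite variant V18960,
the `μ = 0` specialisation of `stub_mulGate_children_extend`). Over `ℝ≥0` nothing cancels: if
`P` is a `×`-gate with `eval P ≠ 0` and plain support inclusion
`(eval P).support ⊆ f.support`, then (1) the support of every child `h` of `P` translates into
`f.support` by some shift `μ` (a fixed monomial of the product of the other children), and
(2) for two distinct children `h ≠ h'`, every sum of a monomial of `eval h` and a monomial of
`eval h'` extends to a monomial of `f`. Immediate from the landed general lemma
`Summit.ValiantsHypothesis.ValiantsHypothesis.Theorems.stub_mulGate_children_extend` with the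
common shift `μ := 0`. [folklore] -/
theorem stub_mulGate_children_extend_var18960 :
    ∀ (n : ℕ) (G : Type) (C : LabelledArithCircuit NNReal (Fin n × Fin n) Unit G)
      (f : MvPolynomial (Fin n × Fin n) NNReal) (P : G), C.label P = .mul → C.eval P ≠ 0 →
      (C.eval P).support ⊆ f.support →
      (∀ h ∈ C.children P, ∃ μ : (Fin n × Fin n) →₀ ℕ, ∀ m ∈ (C.eval h).support,
          m + μ ∈ f.support) ∧
      (∀ h ∈ C.children P, ∀ h' ∈ C.children P, h ≠ h' → ∀ m ∈ (C.eval h).support,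
          ∀ m' ∈ (C.eval h').support, ∃ μ : (Fin n × Fin n) →₀ ℕ, m + m' + μ ∈ f.support) :=
  fun _n _G C f _P hP hP0 hsub =>
    stub_mulGate_children_extend C f hP hP0 ⟨0, fun m hm => by rw [add_zero]; exact hsub hm⟩

end Summit.ValiantsHypothesis.ValiantsHypothesis.Theorems
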